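import Mathlib.Analysis.Calculus.Deriv.Add
import Mathlib.Analysis.Calculus.Deriv.Mul
import Mathlib.Analysis.Calculus.Deriv.MeanValue
import Literature.Probability.Percolation.QSMLocalModification
import Literature.Probability.Percolation.PercolationEvents
import HarnessLib

/-!
# Two-parameter cylinder polynomials, Russo's formula and the Aizenman–Grimmett inequality
# for the column-enhanced model (Martineau–Severo 2019, §6)

Third file of the inline proof of `Literature.Probability.Percolation.martineauSevero_zd3_slabTorus`.
Martineau–Severo (Ann. Probab. 47 (2019), §6) consider `θ_L(p, s) = ℙ_{p,s}(𝓔_L)` under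
`ℙ_{p,s} = Ber(p)^{⊗E(ℋ)} ⊗ Ber(s)^{⊗V(ℋ)}`, apply the Margulis–Russo formula in each parameter,

  `∂θ_L/∂p = Σ_e ℙ_{p,s}(e is p-pivotal for 𝓔_L)`, `∂θ_L/∂s = Σ_x ℙ_{p,s}(x is s-pivotal for 𝓔_L)`,

deduce from Lemma 6.1 the differential inequality (diffineq) `∂θ_L/∂s ≥ c ∂θ_L/∂p` with `c`
uniform in `L`, and integrate it along a line segment `(𝐩(t), 𝐬(t))` with `𝐩'/𝐬' = -c`, along
which `t ↦ θ_L(𝐩(t), 𝐬(t))` is non-decreasing.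

Since `𝓔_L` depends on the finitely many coordinates `K = E_L ⊔ (columns of sup-norm ≤ L)`, all
of this is finite-dimensional and we carry it out on the explicit polynomial

  `Θ_L(p, s) = Σ_{S ⊆ K, S ∈ 𝓔_L} ∏_{i ∈ K} w_i(S)`,  `w_i(S) = p, 1-p, s, 1-s`,

(`SlabTorus.Theta`; its identification with probabilities is made in the sequel files through
`Russo.measureReal_eq_cylPoly`). Contents:

* `ProdWeight.*` — product weights with one parameter per coordinate on a finite set `K`, the
  weighted count `gTheta K A q` of an event and the pivotal counts `gPiv K A q i`; the pairing
  `S ↔ S ∪ {i}` (`sum_sgn_eq_gPiv`, Russo 1981, proof of Lemma 3) and **Russo's formula along a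
  path of parameters** `hasDerivAt_gTheta`; positivity.
* `SlabTorus.Coord n = Sym2 (Vert n) ⊕ Site 2`, the finite coordinate set `SlabTorus.K n L`, the
  event `SlabTorus.ev L` (an upper set determined by `K`), `SlabTorus.Theta`, `SlabTorus.Piv`.
* **The Aizenman–Grimmett inequality** `SlabTorus.sum_piv_inl_le` (Martineau–Severo's (goal)
  summed over `e`): `Σ_e Piv_e ≤ C · Σ_y Piv_y` with `C = C(n, μ₀)` for `min(p, 1-p) ≥ μ₀ > 0`,
  `0 < s ≤ 1/2`, from `SlabTorus.local_modification` by the finite-energy / bounded-fibre count.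
* `SlabTorus.theta_line_mono` — integration: `t ↦ Θ_L(p₀ - κt, t)` is non-decreasing on
  `[0, t₁]` when `κ C ≤ 1`; and `SlabTorus.theta_mono_s` (monotonicity in `s`).

## References

* S. Martineau, F. Severo, Ann. Probab. 47 (2019), §6 ((diffineq), (goal), the line-segment
  argument) [MartineauSevero2019].
* M. Aizenman, G. Grimmett, J. Stat. Phys. 63 (1991) 817–835 [AizenmanGrimmett1991].
* L. Russo, Z. Wahrsch. verw. Gebiete 56 (1981), §4 Lemma 3 (the formula `dμ_x(A)/dx = ⟨n(A)⟩`).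
-/

namespace Literature.Probability.Percolation

open LatticeModels

/-! ## Product weights with one parameter per coordinate -/

namespace ProdWeight

open scoped Classical

variable {ι : Type*}

/-- The one-coordinate weight of the configuration `S` at `i` when coordinate `i` is open with
probability `q i`: `q i` if `i ∈ S`, else `1 - q i` (Russo's `ν_{x_i}`).
[folklore] -/
noncomputable def gwt (q : ι → ℝ) (S : Finset ι) (i : ι) : ℝ := if i ∈ S then q i else 1 - q i

/-- The weight `∏_{i ∈ K} w_i(S)` of the cylinder of `S ⊆ K`. [folklore] -/
noncomputable def gW (K : Finset ι) (q : ι → ℝ) (S : Finset ι) : ℝ := ∏ i ∈ K, gwt q S i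

/-- The weighted count `Σ_{S ⊆ K, S ∈ A} ∏ w_i(S)` of the event `A` (its probability under the
product measure when `A` is determined by `K`). [folklore] -/
noncomputable def gTheta (K : Finset ι) (A : Set (Set ι)) (q : ι → ℝ) : ℝ :=
  ∑ S ∈ K.powerset, if (↑S : Set ι) ∈ A then gW K q S else 0

/-- The weighted count of the configurations in which `i` is pivotal for `A`. [folklore] -/
noncomputable def gPiv (K : Finset ι) (A : Set (Set ι)) (q : ι → ℝ) (i : ι) : ℝ :=
  ∑ S ∈ K.powerset, if IsPivotal A i (↑S : Set ι) then gW K q S else 0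

/-- Off the coordinate `i`, the weights of `S` and `insert i S` agree. [folklore] -/
theorem gwt_insert_of_ne (q : ι → ℝ) (S : Finset ι) {i j : ι} (h : j ≠ i) :
    gwt q (insert i S) j = gwt q S j := by
  simp [gwt, Finset.mem_insert, h]

/-- Weights are non-negative for parameters in `[0, 1]`. [folklore] -/
theorem gwt_nonneg {q : ι → ℝ} (hq : ∀ i, 0 ≤ q i ∧ q i ≤ 1) (S : Finset ι) (i : ι) : 0 ≤ gwt q S i := by
  unfold gwt
  split_ifs
  · exact (hq i).1
  · linarith [(hq i).2]

/-- Weights are at most one for parameters in `[0, 1]`. [folklore] -/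
theorem gwt_le_one {q : ι → ℝ} (hq : ∀ i, 0 ≤ q i ∧ q i ≤ 1) (S : Finset ι) (i : ι) : gwt q S i ≤ 1 := by
  unfold gwt
  split_ifs
  · exact (hq i).2
  · linarith [(hq i).1]

/-- Cylinder weights are non-negative for parameters in `[0, 1]`. [folklore] -/
theorem gW_nonneg (K : Finset ι) {q : ι → ℝ} (hq : ∀ i, 0 ≤ q i ∧ q i ≤ 1) (S : Finset ι) : 0 ≤ gW K q S :=
  Finset.prod_nonneg fun i _ => gwt_nonneg hq S i

/-- Pivotal counts are non-negative for parameters in `[0, 1]`. [folklore] -/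
theorem gPiv_nonneg (K : Finset ι) (A : Set (Set ι)) {q : ι → ℝ} (hq : ∀ i, 0 ≤ q i ∧ q i ≤ 1) (i : ι) :
    0 ≤ gPiv K A q i := by
  refine Finset.sum_nonneg fun S _ => ?_
  split_ifs
  · exact gW_nonneg K hq S
  · exact le_rfl

/-- For an increasing event, `i` is pivotal in `ξ` iff `ξ ∪ {i} ∈ A` and `ξ ∖ {i} ∉ A`. [folklore] -/
theorem isPivotal_iff_of_upper {A : Set (Set ι)} (hA : IsUpperSet A) (i : ι) (ξ : Set ι) :
    IsPivotal A i ξ ↔ insert i ξ ∈ A ∧ ξ \ {i} ∉ A := by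
  unfold IsPivotal
  have himp : ξ \ {i} ∈ A → insert i ξ ∈ A := fun h =>
    hA (Set.sdiff_subset.trans (Set.subset_insert i ξ)) h
  constructor
  · rintro (⟨h1, h2⟩ | ⟨h1, h2⟩)
    · exact ⟨h1, h2⟩
    · exact absurd (himp h1) h2
  · rintro ⟨h1, h2⟩
    exact Or.inl ⟨h1, h2⟩

/-- **The pairing `S ↔ S ∪ {i}`** (Russo 1981, proof of Lemma 3): for an increasing event `A` and
`i ∈ K`, `Σ_{S ⊆ K, S ∈ A} (∏_{j ≠ i} w_j(S)) · (±1) = Σ_{S ⊆ K, i pivotal in S} ∏_j w_j(S)`, the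
sign being `+` if `i ∈ S` and `-` otherwise. [folklore] -/
theorem sum_sgn_eq_gPiv {A : Set (Set ι)} (hA : IsUpperSet A) (K : Finset ι) (q : ι → ℝ) {i : ι}
    (hi : i ∈ K) :
    (∑ S ∈ K.powerset, if (↑S : Set ι) ∈ A then
        (∏ j ∈ K.erase i, gwt q S j) * (if i ∈ S then 1 else -1) else 0) = gPiv K A q i := by
  unfold gPiv gW
  have hpow : K.powerset = (K.erase i).powerset ∪ (K.erase i).powerset.image (insert i) := by
    rw [← Finset.powerset_insert, Finset.insert_erase hi]
  have hdisj : Disjoint (K.erase i).powerset ((K.erase i).powerset.image (insert i)) := by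
    rw [Finset.disjoint_left]
    intro S hS hS'
    obtain ⟨T, -, rfl⟩ := Finset.mem_image.1 hS'
    have := Finset.mem_powerset.1 hS (Finset.mem_insert_self i T)
    simp at this
  have hinj : Set.InjOn (insert i) (↑(K.erase i).powerset : Set (Finset ι)) := by
    intro S hS T hT hST
    have hiS : i ∉ S := fun h => by simpa using Finset.mem_powerset.1 hS h
    have hiT : i ∉ T := fun h => by simpa using Finset.mem_powerset.1 hT h
    rw [← Finset.erase_insert hiS, ← Finset.erase_insert hiT, hST]
  rw [hpow, Finset.sum_union hdisj, Finset.sum_image hinj, ← Finset.sum_add_distrib,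
    Finset.sum_union hdisj, Finset.sum_image hinj, ← Finset.sum_add_distrib]
  refine Finset.sum_congr rfl fun S hS => ?_
  have hiS : i ∉ S := fun h => by simpa using Finset.mem_powerset.1 hS h
  have hiS' : i ∉ (↑S : Set ι) := by simpa using hiS
  -- weights off `i` agree for `S` and `insert i S`
  have hwi : ∏ j ∈ K.erase i, gwt q (insert i S) j = ∏ j ∈ K.erase i, gwt q S j :=
    Finset.prod_congr rfl fun j hj => gwt_insert_of_ne q S (Finset.ne_of_mem_erase hj)
  -- the full products
  have hfull : ∀ T : Finset ι, ∏ j ∈ K, gwt q T j = gwt q T i * ∏ j ∈ K.erase i, gwt q T j :=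
    fun T => (Finset.mul_prod_erase K (gwt q T) hi).symm
  have hpivi : IsPivotal A i (↑(insert i S) : Set ι) ↔ IsPivotal A i (↑S : Set ι) := by
    rw [Finset.coe_insert]
    exact isPivotal_insert_iff A i ↑S
  have hpivS : IsPivotal A i (↑S : Set ι) ↔ insert i (↑S : Set ι) ∈ A ∧ (↑S : Set ι) ∉ A := by
    rw [isPivotal_iff_of_upper hA, Set.sdiff_singleton_eq_self hiS']
  rw [hwi, hfull S, hfull (insert i S), hpivi]
  simp only [Finset.mem_insert, true_or, if_true, hiS, if_false, Finset.coe_insert]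
  have hgS : gwt q S i = 1 - q i := by simp [gwt, hiS]
  have hgI : gwt q (insert i S) i = q i := by simp [gwt]
  rw [hgS, hgI, ← hwi]
  by_cases hSA : (↑S : Set ι) ∈ A
  · have hIA : insert i (↑S : Set ι) ∈ A := hA (Set.subset_insert i _) hSA
    have hnp : ¬ IsPivotal A i (↑S : Set ι) := fun h => (hpivS.1 h).2 hSA
    simp [hSA, hIA, hnp]
  · by_cases hIA : insert i (↑S : Set ι) ∈ A
    · have hp : IsPivotal A i (↑S : Set ι) := hpivS.2 ⟨hIA, hSA⟩
      simp [hSA, hIA, hp]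
      ring
    · have hnp : ¬ IsPivotal A i (↑S : Set ι) := fun h => hIA (hpivS.1 h).1
      simp [hSA, hIA, hnp]

/-- **Russo's formula along a path of parameters.** If every coordinate's parameter `t ↦ q_t(i)` is
differentiable at `t` with derivative `dq i`, then for an increasing event `A` determined inside `K`
the weighted count `t ↦ Σ_{S ⊆ K, S ∈ A} ∏ w_i(S)` has derivative `Σ_{i ∈ K} dq i · Piv_i` at `t`
(Russo 1981, Lemma 3: `∂/∂x_i μ_x(A) = μ_x(δ_i A)`, chain rule). [folklore] -/
theorem hasDerivAt_gTheta {A : Set (Set ι)} (hA : IsUpperSet A) (K : Finset ι) {q : ℝ → ι → ℝ}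
    {dq : ι → ℝ} {t : ℝ} (hq : ∀ i ∈ K, HasDerivAt (fun t => q t i) (dq i) t) :
    HasDerivAt (fun t => gTheta K A (q t)) (∑ i ∈ K, dq i * gPiv K A (q t) i) t := by
  -- derivative of one weight
  have hw : ∀ (S : Finset ι), ∀ i ∈ K, HasDerivAt (fun t => gwt (q t) S i)
      ((if i ∈ S then 1 else -1) * dq i) t := by
    intro S i hi
    by_cases hiS : i ∈ S
    · simp only [gwt, hiS, if_true, one_mul]
      exact hq i hi
    · simp only [gwt, hiS, if_false, neg_mul, one_mul]
      exact (hq i hi).const_sub 1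
  -- derivative of a cylinder weight
  have hW : ∀ S : Finset ι, HasDerivAt (fun t => gW K (q t) S)
      (∑ i ∈ K, (∏ j ∈ K.erase i, gwt (q t) S j) * ((if i ∈ S then 1 else -1) * dq i)) t := by
    intro S
    have := HasDerivAt.fun_finsetProd (u := K) (x := t) (fun i hi => hw S i hi)
    simpa [gW, smul_eq_mul] using this
  -- sum over the event
  have hT : HasDerivAt (fun t => gTheta K A (q t))
      (∑ S ∈ K.powerset, if (↑S : Set ι) ∈ A then
        ∑ i ∈ K, (∏ j ∈ K.erase i, gwt (q t) S j) * ((if i ∈ S then 1 else -1) * dq i) else 0) t := by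
    unfold gTheta
    refine HasDerivAt.fun_sum fun S _ => ?_
    split_ifs with hSA
    · exact hW S
    · simpa using hasDerivAt_const t (0 : ℝ)
  refine hT.congr_deriv ?_
  -- exchange the sums and pair
  have hswap : (∑ S ∈ K.powerset, if (↑S : Set ι) ∈ A then
        ∑ i ∈ K, (∏ j ∈ K.erase i, gwt (q t) S j) * ((if i ∈ S then 1 else -1) * dq i) else 0) =
      ∑ i ∈ K, dq i * ∑ S ∈ K.powerset, (if (↑S : Set ι) ∈ A then
        (∏ j ∈ K.erase i, gwt (q t) S j) * (if i ∈ S then 1 else -1) else 0) := by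
    have : ∀ S ∈ K.powerset, (if (↑S : Set ι) ∈ A then
        ∑ i ∈ K, (∏ j ∈ K.erase i, gwt (q t) S j) * ((if i ∈ S then 1 else -1) * dq i) else 0) =
        ∑ i ∈ K, (if (↑S : Set ι) ∈ A then
          (∏ j ∈ K.erase i, gwt (q t) S j) * ((if i ∈ S then 1 else -1) * dq i) else 0) := by
      intro S _
      split_ifs
      · rfl
      · simp
    rw [Finset.sum_congr rfl this, Finset.sum_comm]
    refine Finset.sum_congr rfl fun i _ => ?_
    rw [Finset.mul_sum]
    refine Finset.sum_congr rfl fun S _ => ?_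
    split_ifs <;> ring
  rw [hswap]
  refine Finset.sum_congr rfl fun i hi => ?_
  rw [sum_sgn_eq_gPiv hA K (q t) hi]

/-- The weighted count only sees the parameters of coordinates in `K`. [folklore] -/
theorem gW_congr (K : Finset ι) {q q' : ι → ℝ} (h : ∀ i ∈ K, q i = q' i) (S : Finset ι) :
    gW K q S = gW K q' S :=
  Finset.prod_congr rfl fun i hi => by simp [gwt, h i hi]

end ProdWeight

/-! ## The coordinates of the column model -/

namespace SlabTorus

variable {n : ℕ}

/-- The coordinate type of the two-parameter model on `ℋ_n`: an edge of `ℋ_n` (parameter `p`) or a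
column of `ℤ²` (mark, parameter `s`). [cite: MartineauSevero2019, §4 (ℙ_{p,s})] -/
abbrev Coord (n : ℕ) : Type := Sym2 (Vert n) ⊕ Site 2

/-- The event `𝓔_L` on combined configurations `ξ ⊆ Coord n` (edges `inl⁻¹ ξ`, marks `inr⁻¹ ξ`).
[cite: MartineauSevero2019, §6 (𝓔_L)] -/
def ev (L : ℕ) : Set (Set (Coord n)) :=
  {ξ | Reaches L (Sum.inl ⁻¹' ξ) (Sum.inr ⁻¹' ξ)}

/-- `𝓔_L` is increasing. [cite: MartineauSevero2019, §6] -/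
theorem isUpperSet_ev (L : ℕ) : IsUpperSet (ev (n := n) L) := by
  intro ξ ξ' hle h
  exact Reaches.mono (fun e he => hle he) (fun y hy => hle hy) h

/-- Edges of `ξ ∪ {inl e}`: `inl⁻¹(ξ ∪ {inl e}) = inl⁻¹ ξ ∪ {e}`. [folklore] -/
@[simp] theorem preimage_inl_insert_inl (ξ : Set (Coord n)) (e : Sym2 (Vert n)) :
    Sum.inl ⁻¹' (insert (Sum.inl e) ξ) = insert e (Sum.inl ⁻¹' ξ) := by
  ext f; simp

/-- Marks of `ξ ∪ {inl e}` are those of `ξ`. [folklore] -/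
@[simp] theorem preimage_inr_insert_inl (ξ : Set (Coord n)) (e : Sym2 (Vert n)) :
    Sum.inr ⁻¹' (insert (Sum.inl e : Coord n) ξ) = Sum.inr ⁻¹' ξ := by
  ext y; simp

/-- Edges of `ξ ∖ {inl e}`. [folklore] -/
@[simp] theorem preimage_inl_diff_inl (ξ : Set (Coord n)) (e : Sym2 (Vert n)) :
    Sum.inl ⁻¹' (ξ \ {Sum.inl e}) = (Sum.inl ⁻¹' ξ) \ {e} := by
  ext f; simp

/-- Marks of `ξ ∖ {inl e}` are those of `ξ`. [folklore] -/
@[simp] theorem preimage_inr_diff_inl (ξ : Set (Coord n)) (e : Sym2 (Vert n)) :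
    Sum.inr ⁻¹' (ξ \ {(Sum.inl e : Coord n)}) = Sum.inr ⁻¹' ξ := by
  ext y; simp

/-- Edges of `ξ ∪ {inr y}` are those of `ξ`. [folklore] -/
@[simp] theorem preimage_inl_insert_inr (ξ : Set (Coord n)) (y : Site 2) :
    Sum.inl ⁻¹' (insert (Sum.inr y : Coord n) ξ) = Sum.inl ⁻¹' ξ := by
  ext f; simp

/-- Marks of `ξ ∪ {inr y}`. [folklore] -/
@[simp] theorem preimage_inr_insert_inr (ξ : Set (Coord n)) (y : Site 2) :
    Sum.inr ⁻¹' (insert (Sum.inr y : Coord n) ξ) = insert y (Sum.inr ⁻¹' ξ) := by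
  ext y'; simp

/-- Edges of `ξ ∖ {inr y}` are those of `ξ`. [folklore] -/
@[simp] theorem preimage_inl_diff_inr (ξ : Set (Coord n)) (y : Site 2) :
    Sum.inl ⁻¹' (ξ \ {(Sum.inr y : Coord n)}) = Sum.inl ⁻¹' ξ := by
  ext f; simp

/-- Marks of `ξ ∖ {inr y}`. [folklore] -/
@[simp] theorem preimage_inr_diff_inr (ξ : Set (Coord n)) (y : Site 2) :
    Sum.inr ⁻¹' (ξ \ {(Sum.inr y : Coord n)}) = (Sum.inr ⁻¹' ξ) \ {y} := by
  ext y'; simp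

/-- `p`-pivotality of the edge `e` on combined configurations, unfolded. [cite: MartineauSevero2019, §6] -/
theorem isPivotal_inl_iff (L : ℕ) (e : Sym2 (Vert n)) (ξ : Set (Coord n)) :
    IsPivotal (ev L) (Sum.inl e) ξ ↔
      Reaches L (insert e (Sum.inl ⁻¹' ξ)) (Sum.inr ⁻¹' ξ) ∧ ¬ Reaches L ((Sum.inl ⁻¹' ξ) \ {e}) (Sum.inr ⁻¹' ξ) := by
  rw [ProdWeight.isPivotal_iff_of_upper (isUpperSet_ev L)]
  simp only [ev, Set.mem_setOf_eq, preimage_inl_insert_inl, preimage_inr_insert_inl,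
    preimage_inl_diff_inl, preimage_inr_diff_inl]

/-- `s`-pivotality of the column `y` on combined configurations, unfolded. [cite: MartineauSevero2019, §6] -/
theorem isPivotal_inr_iff (L : ℕ) (y : Site 2) (ξ : Set (Coord n)) :
    IsPivotal (ev L) (Sum.inr y) ξ ↔
      Reaches L (Sum.inl ⁻¹' ξ) (insert y (Sum.inr ⁻¹' ξ)) ∧ ¬ Reaches L (Sum.inl ⁻¹' ξ) ((Sum.inr ⁻¹' ξ) \ {y}) := by
  rw [ProdWeight.isPivotal_iff_of_upper (isUpperSet_ev L)]
  simp only [ev, Set.mem_setOf_eq, preimage_inl_insert_inr, preimage_inr_insert_inr,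
    preimage_inl_diff_inr, preimage_inr_diff_inr]


/-! ### Directions and neighbours -/

/-- The six lattice directions: an axis of `ℤ³` and a sign. Axis `0` acts on the residue of
`ℋ_n`, axes `1, 2` on the planar coordinates. [folklore] -/
abbrev Dir : Type := Fin 3 × Bool

/-- The unit vector of `ℤ³` in direction `d`. [folklore] -/
def dvec (d : Dir) : Site 3 := if d.2 then Pi.single d.1 1 else -Pi.single d.1 1

/-- The neighbour of the vertex `a` of `ℋ_n` in direction `d`: the image of `x + dvec d` for any
lift `x` of `a` (first coordinate of `dvec d` added to the residue, tail to the column). [folklore] -/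
def nbr (a : Vert n) (d : Dir) : Vert n := (a.1 + ((dvec d 0 : ℤ) : ZMod n), a.2 + tail3 (dvec d))

/-- First coordinate and tail of the vertical unit vectors. [folklore] -/
theorem dvec_zero_true : dvec ((0 : Fin 3), true) 0 = 1 ∧ tail3 (dvec ((0 : Fin 3), true)) = 0 := by
  refine ⟨by simp [dvec], ?_⟩
  funext j; simp [dvec, tail3, Fin.succ_ne_zero]

/-- First coordinate and tail of the downward unit vector. [folklore] -/
theorem dvec_zero_false : dvec ((0 : Fin 3), false) 0 = -1 ∧ tail3 (dvec ((0 : Fin 3), false)) = 0 := by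
  refine ⟨by simp [dvec], ?_⟩
  funext j; simp [dvec, tail3, Fin.succ_ne_zero]

/-- First coordinate and tail of the horizontal unit vectors. [folklore] -/
theorem dvec_succ (i : Fin 2) (b : Bool) : dvec (i.succ, b) 0 = 0 ∧
    tail3 (dvec (i.succ, b)) = if b then Pi.single i 1 else -Pi.single i 1 := by
  cases b
  · refine ⟨by simp [dvec, Fin.succ_ne_zero], ?_⟩
    funext j; simp [dvec, tail3, Pi.single_apply, Fin.succ_inj]
  · refine ⟨by simp [dvec, Fin.succ_ne_zero], ?_⟩
    funext j; simp [dvec, tail3, Pi.single_apply, Fin.succ_inj]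

/-- The vertical neighbours: `nbr a (0, ±) = (a.1 ± 1, a.2)`. [folklore] -/
theorem nbr_zero (a : Vert n) : nbr a ((0 : Fin 3), true) = (a.1 + 1, a.2) ∧
    nbr a ((0 : Fin 3), false) = (a.1 - 1, a.2) := by
  constructor
  · simp only [nbr, dvec_zero_true.1, dvec_zero_true.2, add_zero, Int.cast_one]
  · simp only [nbr, dvec_zero_false.1, dvec_zero_false.2, add_zero, Int.cast_neg, Int.cast_one,
      sub_eq_add_neg]

/-- The horizontal neighbours: `nbr a (i+1, ±) = (a.1, a.2 ± eᵢ)`. [folklore] -/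
theorem nbr_succ (a : Vert n) (i : Fin 2) (b : Bool) :
    nbr a (i.succ, b) = (a.1, a.2 + if b then Pi.single i 1 else -Pi.single i 1) := by
  simp only [nbr, (dvec_succ i b).1, (dvec_succ i b).2, Int.cast_zero, add_zero]

/-- Every neighbour in `ℋ_n` is `nbr a d` for some direction `d`. [folklore] -/
theorem exists_dir_of_adj {a b : Vert n} (h : (slabTorusGraph n).Adj a b) : ∃ d : Dir, b = nbr a d := by
  rcases adj_cases h with ⟨h1, h2⟩ | ⟨h1, -, h3 | h3⟩
  · rw [zdGraph_adj_iff] at h2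
    obtain ⟨i, h2 | h2⟩ := h2
    · refine ⟨(i.succ, true), ?_⟩
      rw [nbr_succ]
      ext <;> simp [h1, h2]
    · refine ⟨(i.succ, false), ?_⟩
      rw [nbr_succ]
      ext <;> simp [h1, h2]
  · refine ⟨((0 : Fin 3), true), ?_⟩
    rw [(nbr_zero a).1]
    ext <;> simp [h1, h3]
  · refine ⟨((0 : Fin 3), false), ?_⟩
    rw [(nbr_zero a).2]
    ext <;> simp [h1, h3]

/-- `nbr a d` is adjacent to `a` (for `n ≠ 1`, so that vertical steps are not loops). [folklore] -/
theorem adj_nbr (hn : n ≠ 1) (a : Vert n) (d : Dir) : (slabTorusGraph n).Adj a (nbr a d) := by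
  obtain ⟨i, b⟩ := d
  refine Fin.cases ?_ (fun j => ?_) i
  · cases b
    · rw [(nbr_zero a).2]
      have h := (adj_vertical hn (a.1 - 1) a.2)
      rw [sub_add_cancel] at h
      exact h.symm
    · rw [(nbr_zero a).1]
      exact adj_vertical hn a.1 a.2
  · rw [nbr_succ]
    refine adj_horizontal a.1 ?_
    rw [zdGraph_adj_iff]
    cases b
    · exact ⟨j, Or.inr (by simp)⟩
    · exact ⟨j, Or.inl (by simp)⟩

/-! ### The finite coordinate set -/

section Finite

variable [NeZero n]

/-- The edges of `E_L` as a finite set: `s(a, nbr a d)` over vertices `a` with column in `box 2 L`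
and directions `d`. [cite: MartineauSevero2019, §6] -/
noncomputable def KE (n : ℕ) [NeZero n] (L : ℕ) : Finset (Sym2 (Vert n)) :=
  ((Finset.univ : Finset (ZMod n)) ×ˢ box 2 L ×ˢ (Finset.univ : Finset Dir)).image
    fun p => s(((p.1, p.2.1) : Vert n), nbr (p.1, p.2.1) p.2.2)

/-- Membership in `KE`: `e = s(a, nbr a d)` with `‖a.2‖∞ ≤ L`. [folklore] -/
theorem mem_KE_iff {L : ℕ} {e : Sym2 (Vert n)} :
    e ∈ KE n L ↔ ∃ (a : Vert n) (d : Dir), pnorm a.2 ≤ L ∧ e = s(a, nbr a d) := by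
  simp only [KE, Finset.mem_image, Finset.mem_product, Finset.mem_univ, true_and, and_true]
  constructor
  · rintro ⟨⟨t, y, d⟩, hy, rfl⟩
    exact ⟨(t, y), d, mem_box_iff_pnorm_le.1 hy, rfl⟩
  · rintro ⟨a, d, ha, rfl⟩
    exact ⟨(a.1, a.2, d), mem_box_iff_pnorm_le.2 ha, rfl⟩

/-- `KE` is the edge set `E_L` (for `n ≠ 1`). [folklore] -/
theorem mem_KE_iff_mem_EL (hn : n ≠ 1) {L : ℕ} {e : Sym2 (Vert n)} : e ∈ KE n L ↔ e ∈ EL n L := by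
  rw [mem_KE_iff]
  constructor
  · rintro ⟨a, d, ha, rfl⟩
    exact mk_mem_EL_iff.2 ⟨adj_nbr hn a d, Or.inl ha⟩
  · intro he
    obtain ⟨he1, x, hx, hxL⟩ := he
    induction e using Sym2.ind with
    | _ u v =>
      have huv : (slabTorusGraph n).Adj u v := he1
      rcases Sym2.mem_iff.1 hx with rfl | rfl
      · obtain ⟨d, rfl⟩ := exists_dir_of_adj huv
        exact ⟨x, d, hxL, rfl⟩
      · obtain ⟨d, rfl⟩ := exists_dir_of_adj huv.symm
        exact ⟨x, d, hxL, Sym2.eq_swap⟩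

/-- Edges of `KE` are edges of `ℋ_n` (`n ≠ 1`). [folklore] -/
theorem mem_edgeSet_of_mem_KE (hn : n ≠ 1) {L : ℕ} {e : Sym2 (Vert n)} (he : e ∈ KE n L) :
    e ∈ (slabTorusGraph n).edgeSet :=
  ((mem_KE_iff_mem_EL hn).1 he).1

/-- The finite coordinate set `K = E_L ⊔ box L` determining `𝓔_L`. [cite: MartineauSevero2019, §6] -/
noncomputable def K (n : ℕ) [NeZero n] (L : ℕ) : Finset (Coord n) := (KE n L).disjSum (box 2 L)

/-- Edge coordinates of `K`. [folklore] -/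
@[simp] theorem inl_mem_K {L : ℕ} {e : Sym2 (Vert n)} : (Sum.inl e : Coord n) ∈ K n L ↔ e ∈ KE n L :=
  Finset.inl_mem_disjSum

/-- Mark coordinates of `K`. [folklore] -/
@[simp] theorem inr_mem_K {L : ℕ} {y : Site 2} : (Sum.inr y : Coord n) ∈ K n L ↔ y ∈ box 2 L :=
  Finset.inr_mem_disjSum

/-- The edges of `ℋ_n` meeting the column `K_c`, as a finite set (`≤ 6n` of them). [folklore] -/
noncomputable def colEF (n : ℕ) [NeZero n] (c : Site 2) : Finset (Sym2 (Vert n)) :=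
  ((Finset.univ : Finset (ZMod n)) ×ˢ (Finset.univ : Finset Dir)).image
    fun p => s(((p.1, c) : Vert n), nbr (p.1, c) p.2)

/-- `|colEF c| ≤ 6n`. [folklore] -/
theorem card_colEF_le (c : Site 2) : (colEF n c).card ≤ 6 * n := by
  refine Finset.card_image_le.trans ?_
  rw [Finset.card_product, Finset.card_univ, Finset.card_univ, ZMod.card]
  simp [Fintype.card_prod, Fintype.card_bool, mul_comm]

/-- An edge of `ℋ_n` meeting `K_c` belongs to `colEF c`. [folklore] -/
theorem mem_colEF_of_colE {c : Site 2} {e : Sym2 (Vert n)} (he : e ∈ colE n c)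
    (he' : e ∈ (slabTorusGraph n).edgeSet) : e ∈ colEF n c := by
  simp only [colEF, Finset.mem_image, Finset.mem_product, Finset.mem_univ, true_and]
  induction e using Sym2.ind with
  | _ u v =>
    have huv : (slabTorusGraph n).Adj u v := he'
    rcases mk_mem_colE_iff.1 he with h | h
    · obtain ⟨d, rfl⟩ := exists_dir_of_adj huv
      exact ⟨(u.1, d), by rw [← h]⟩
    · obtain ⟨d, hd⟩ := exists_dir_of_adj huv.symm
      refine ⟨(v.1, d), ?_⟩
      rw [Sym2.eq_swap, hd, ← h]

/-- Edges of `colEF c` meet `K_c`. [folklore] -/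
theorem colE_of_mem_colEF {c : Site 2} {e : Sym2 (Vert n)} (he : e ∈ colEF n c) : e ∈ colE n c := by
  simp only [colEF, Finset.mem_image, Finset.mem_product, Finset.mem_univ, true_and] at he
  obtain ⟨⟨t, d⟩, rfl⟩ := he
  exact mk_mem_colE_iff.2 (Or.inl rfl)

/-- The columns near `c`, as a finite set (`≤ 5` of them). [folklore] -/
noncomputable def nearF (c : Site 2) : Finset (Site 2) :=
  insert c ((Finset.univ : Finset (Fin 2 × Bool)).image
    fun q => c + if q.2 then Pi.single q.1 1 else -Pi.single q.1 1)

/-- `|nearF c| ≤ 5`. [folklore] -/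
theorem card_nearF_le (c : Site 2) : (nearF c).card ≤ 5 := by
  refine (Finset.card_insert_le _ _).trans ?_
  have : ((Finset.univ : Finset (Fin 2 × Bool)).image
      fun q => c + if q.2 then Pi.single q.1 1 else -Pi.single q.1 1).card ≤ 4 :=
    Finset.card_image_le.trans (by simp)
  omega

/-- Columns near `c` belong to `nearF c`. [folklore] -/
theorem mem_nearF_of_nearCol {c y : Site 2} (h : y ∈ nearCol c) : y ∈ nearF c := by
  rcases h with rfl | h
  · exact Finset.mem_insert_self _ _
  · refine Finset.mem_insert_of_mem (Finset.mem_image.2 ?_)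
    rw [zdGraph_adj_iff] at h
    obtain ⟨i, h | h⟩ := h
    · exact ⟨(i, true), Finset.mem_univ _, by simp [h]⟩
    · exact ⟨(i, false), Finset.mem_univ _, by simp [h]⟩

/-- Nearness is symmetric on `nearF`: `y ∈ nearF c → c ∈ nearF y`. [folklore] -/
theorem mem_nearF_comm {c y : Site 2} (h : y ∈ nearF c) : c ∈ nearF y := by
  simp only [nearF, Finset.mem_insert, Finset.mem_image, Finset.mem_univ, true_and, Prod.exists] at h ⊢
  rcases h with rfl | ⟨i, b, rfl⟩
  · exact Or.inl rfl
  · refine Or.inr ⟨i, !b, ?_⟩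
    cases b <;> simp

/-- The coordinates that the local modification at column `c` may change: edges meeting `K_c`
and marks near `c` (`≤ 6n + 5` coordinates). [cite: MartineauSevero2019, §6 Lemma 6.1 (B_R(e))] -/
noncomputable def LocF (n : ℕ) [NeZero n] (c : Site 2) : Finset (Coord n) := (colEF n c).disjSum (nearF c)

/-- `|LocF c| ≤ 6n + 5`. [folklore] -/
theorem card_LocF_le (c : Site 2) : (LocF n c).card ≤ 6 * n + 5 := by
  rw [LocF, Finset.card_disjSum]
  exact Nat.add_le_add (card_colEF_le c) (card_nearF_le c)

end Finite

/-! ### The polynomial `Θ_L(p, s)` and the pivotal counts -/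

/-- The parameter of a coordinate: `p` for edges, `s` for marks. [cite: MartineauSevero2019, §4 (ℙ_{p,s})] -/
def par (p s : ℝ) : Coord n → ℝ := fun i => Sum.elim (fun _ => p) (fun _ => s) i

/-- Parameters in `[0, 1]` coordinatewise. [folklore] -/
theorem par_mem {p s : ℝ} (hp : 0 ≤ p ∧ p ≤ 1) (hs : 0 ≤ s ∧ s ≤ 1) (i : Coord n) :
    0 ≤ par p s i ∧ par p s i ≤ 1 := by
  cases i with
  | inl _ => exact hp
  | inr _ => exact hs

section Theta

variable [NeZero n]

/-- **`Θ_L(p, s) = Σ_{S ⊆ K, S ∈ 𝓔_L} p^{|ω|} (1-p)^{|E_L|-|ω|} s^{|α|} (1-s)^{|V_L|-|α|}`**, the finite-volume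
percolation probability `θ_L(p, s) = ℙ_{p,s}(𝓔_L)` of Martineau–Severo, §6, written as the explicit
polynomial it is. [cite: MartineauSevero2019, §6 (θ_L(p,s))] -/
noncomputable def Theta (n : ℕ) [NeZero n] (L : ℕ) (p s : ℝ) : ℝ :=
  ProdWeight.gTheta (K n L) (ev L) (par p s)

/-- The weighted count of configurations in which the coordinate `i` is pivotal for `𝓔_L`
(`ℙ_{p,s}(e is p-pivotal)`, `ℙ_{p,s}(x is s-pivotal)` of §6). [cite: MartineauSevero2019, §6] -/
noncomputable def Piv (n : ℕ) [NeZero n] (L : ℕ) (p s : ℝ) (i : Coord n) : ℝ :=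
  ProdWeight.gPiv (K n L) (ev L) (par p s) i

/-- Pivotal counts are non-negative. [folklore] -/
theorem piv_nonneg (L : ℕ) {p s : ℝ} (hp : 0 ≤ p ∧ p ≤ 1) (hs : 0 ≤ s ∧ s ≤ 1) (i : Coord n) :
    0 ≤ Piv n L p s i :=
  ProdWeight.gPiv_nonneg _ _ (par_mem hp hs) i

/-- **Russo's formula for `Θ_L` along the line `(p₀ - κt, t)`** (Martineau–Severo, §6: "the
Margulis–Russo formula gives us `∂θ_L/∂p = Σ_e ℙ(e is p-pivotal)`, `∂θ_L/∂s = Σ_x ℙ(x is s-pivotal)`",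
combined by the chain rule along `𝐩'(t)/𝐬'(t) = -c`).
[cite: MartineauSevero2019, §6 (Margulis–Russo formula)] -/
theorem hasDerivAt_theta_line (L : ℕ) (p₀ κ t : ℝ) :
    HasDerivAt (fun t => Theta n L (p₀ - κ * t) t)
      (-κ * ∑ e ∈ KE n L, Piv n L (p₀ - κ * t) t (Sum.inl e) +
        ∑ y ∈ box 2 L, Piv n L (p₀ - κ * t) t (Sum.inr y)) t := by
  have hq : ∀ i ∈ K n L, HasDerivAt (fun t => par (n := n) (p₀ - κ * t) t i)
      (Sum.elim (fun _ => -κ) (fun _ => (1 : ℝ)) i) t := by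
    intro i _
    cases i with
    | inl e =>
      simp only [par, Sum.elim_inl]
      have := ((hasDerivAt_id t).const_mul κ).const_sub p₀
      simpa using this
    | inr y =>
      simp only [par, Sum.elim_inr]
      exact hasDerivAt_id t
  have h := ProdWeight.hasDerivAt_gTheta (isUpperSet_ev L) (K n L) hq
  refine h.congr_deriv ?_
  simp only [Piv, K, Finset.sum_disjSum, Sum.elim_inl, Sum.elim_inr, one_mul, Finset.mul_sum]

end Theta


/-! ### The Aizenman–Grimmett inequality -/

section AG

variable [NeZero n]

open scoped Classical

/-- A chosen representation `e = s(a, nbr a d)` with `‖a.2‖∞ ≤ L` of an edge of `KE n L`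
(junk outside `KE n L`). [folklore] -/
noncomputable def baseOf (L : ℕ) (e : Sym2 (Vert n)) : Vert n × Dir :=
  if h : ∃ p : Vert n × Dir, pnorm p.1.2 ≤ L ∧ e = s(p.1, nbr p.1 p.2) then h.choose
  else (origin n, ((0 : Fin 3), true))

/-- The defining property of `baseOf`. [folklore] -/
theorem baseOf_spec {L : ℕ} {e : Sym2 (Vert n)} (he : e ∈ KE n L) :
    pnorm (baseOf L e).1.2 ≤ L ∧ e = s((baseOf L e).1, nbr (baseOf L e).1 (baseOf L e).2) := by
  have h : ∃ p : Vert n × Dir, pnorm p.1.2 ≤ L ∧ e = s(p.1, nbr p.1 p.2) := by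
    obtain ⟨a, d, ha, rfl⟩ := mem_KE_iff.1 he
    exact ⟨(a, d), ha, rfl⟩
  rw [baseOf, dif_pos h]
  exact h.choose_spec

/-- The column `c(e)` at which the local modification for the edge `e` takes place. [folklore] -/
noncomputable def colOf (L : ℕ) (e : Sym2 (Vert n)) : Site 2 := (baseOf L e).1.2

/-- An edge of `KE n L` meets its own column `c(e)`, hence lies in `colEF (c e)`. [folklore] -/
theorem mem_colEF_colOf (hn : n ≠ 1) {L : ℕ} {e : Sym2 (Vert n)} (he : e ∈ KE n L) :
    e ∈ colEF n (colOf L e) := by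
  obtain ⟨-, h2⟩ := baseOf_spec he
  refine mem_colEF_of_colE ⟨(baseOf L e).1, ?_, rfl⟩ (mem_edgeSet_of_mem_KE hn he)
  set x := baseOf L e with hx
  rw [h2]
  exact Sym2.mem_mk_left _ _

/-- **One local modification, on finite configurations.** For `e ∈ KE n L` pivotal in `S ⊆ K`,
there is `S' ⊆ K` in which some column `y ∈ box L` near `c(e)` is pivotal, whose weight is at least
`μ₀^{6n}` times that of `S` (`μ₀ ≤ min(p, 1-p)`, `s ≤ 1/2`: finite energy on the `≤ 6n` changed edges,
marks only removed), and which agrees with `S` off `LocF (c e)`.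
[cite: MartineauSevero2019, §6 (Lemma 6.1 ⟹ (goal))] -/
theorem exists_modified (hn : 3 ≤ n) {L : ℕ} {p s μ₀ : ℝ} (hμ₀ : 0 ≤ μ₀) (hμ1 : μ₀ ≤ 1)
    (hμp : μ₀ ≤ p) (hμp' : μ₀ ≤ 1 - p) (hs0 : 0 ≤ s) (hs1 : s ≤ 1) (hs : s ≤ 1 / 2)
    {e : Sym2 (Vert n)} (he : e ∈ KE n L)
    {S : Finset (Coord n)} (hSK : S ⊆ K n L) (hpiv : IsPivotal (ev L) (Sum.inl e) (↑S : Set (Coord n))) :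
    ∃ S' : Finset (Coord n), S' ⊆ K n L ∧
      (∃ y ∈ box 2 L, y ∈ nearF (colOf L e) ∧ IsPivotal (ev L) (Sum.inr y) (↑S' : Set (Coord n))) ∧
      μ₀ ^ (6 * n) * ProdWeight.gW (K n L) (par p s) S ≤ ProdWeight.gW (K n L) (par p s) S' ∧
      S.filter (fun i => i ∉ LocF n (colOf L e)) = S'.filter (fun i => i ∉ LocF n (colOf L e)) := by
  have hn1 : n ≠ 1 := by omega
  obtain ⟨haL, heq⟩ := baseOf_spec he
  set a : Vert n := (baseOf L e).1 with ha_def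
  set d : Dir := (baseOf L e).2 with hd_def
  have hc : colOf L e = a.2 := rfl
  set c : Site 2 := colOf L e with hc_def
  set ω : Set (Sym2 (Vert n)) := Sum.inl ⁻¹' (↑S : Set (Coord n)) with hω
  set α : Set (Site 2) := Sum.inr ⁻¹' (↑S : Set (Coord n)) with hα
  have hpiv' := (isPivotal_inl_iff L e ↑S).1 hpiv
  rw [heq] at hpiv'
  obtain ⟨ω', α', y, H1, H2, H3, H4, H5, H6, H7, H8⟩ :=
    local_modification hn (adj_nbr hn1 a d) haL hpiv'.1 hpiv'.2
  -- the new finite configuration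
  set S' : Finset (Coord n) := (K n L).filter fun i => Sum.elim (fun f => f ∈ ω') (fun y' => y' ∈ α') i
    with hS'
  have hS'K : S' ⊆ K n L := Finset.filter_subset _ _
  have memS'_inl : ∀ f, (Sum.inl f : Coord n) ∈ S' ↔ f ∈ KE n L ∧ f ∈ ω' := fun f => by
    simp [hS']
  have memS'_inr : ∀ y', (Sum.inr y' : Coord n) ∈ S' ↔ y' ∈ box 2 L ∧ y' ∈ α' := fun y' => by
    simp [hS']
  have memS_inl : ∀ f, (Sum.inl f : Coord n) ∈ S ↔ f ∈ ω := fun f => by simp [hω]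
  have memS_inr : ∀ y', (Sum.inr y' : Coord n) ∈ S ↔ y' ∈ α := fun y' => by simp [hα]
  -- marks only decrease
  have hinr : ∀ y', (Sum.inr y' : Coord n) ∈ S' → (Sum.inr y' : Coord n) ∈ S := fun y' h =>
    (memS_inr y').2 (H3 ((memS'_inr y').1 h).2)
  -- off `LocF c` nothing changes
  have hoff : ∀ i, i ∉ LocF n c → (i ∈ S ↔ i ∈ S') := by
    intro i hi
    cases i with
    | inl f =>
      have hf : f ∉ colEF n c := fun h => hi (Finset.inl_mem_disjSum.2 h)
      constructor
      · intro hS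
        have hfK : f ∈ KE n L := inl_mem_K.1 (hSK hS)
        have hfc : f ∉ colE n c := fun h => hf (mem_colEF_of_colE h (mem_edgeSet_of_mem_KE hn1 hfK))
        exact (memS'_inl f).2 ⟨hfK, (H1 f hfc).2 ((memS_inl f).1 hS)⟩
      · intro hS'
        obtain ⟨hfK, hfω'⟩ := (memS'_inl f).1 hS'
        have hfc : f ∉ colE n c := fun h => hf (mem_colEF_of_colE h (mem_edgeSet_of_mem_KE hn1 hfK))
        exact (memS_inl f).2 ((H1 f hfc).1 hfω')
    | inr y' =>
      have hy' : y' ∉ nearF c := fun h => hi (Finset.inr_mem_disjSum.2 h)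
      constructor
      · intro hS
        have hyK : y' ∈ box 2 L := inr_mem_K.1 (hSK hS)
        have hyα : y' ∈ α := (memS_inr y').1 hS
        have hyα' : y' ∈ α' := by
          by_contra h
          exact hy' (mem_nearF_of_nearCol (H4 y' hyα h))
        exact (memS'_inr y').2 ⟨hyK, hyα'⟩
      · exact hinr y'
  refine ⟨S', hS'K, ⟨y, mem_box_iff_pnorm_le.2 H6, mem_nearF_of_nearCol H5, ?_⟩, ?_, ?_⟩
  · -- `y` is pivotal in `S'`
    rw [isPivotal_inr_iff]
    constructor
    · refine H7.congr hn1 (fun f hf hfω' => ?_) (fun y' hy'L hy' => ?_)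
      · change (Sum.inl f : Coord n) ∈ (↑S' : Set (Coord n))
        rw [Finset.mem_coe, memS'_inl]
        exact ⟨(mem_KE_iff_mem_EL hn1).2 hf, hfω'⟩
      · rcases Set.mem_insert_iff.1 hy' with rfl | hy'
        · exact Set.mem_insert _ _
        · refine Set.mem_insert_of_mem _ ?_
          change (Sum.inr y' : Coord n) ∈ (↑S' : Set (Coord n))
          rw [Finset.mem_coe, memS'_inr]
          exact ⟨mem_box_iff_pnorm_le.2 hy'L, hy'⟩
    · intro h
      refine H8 (h.mono (fun f hf => ?_) (fun y' hy' => ?_))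
      · have : (Sum.inl f : Coord n) ∈ S' := by simpa using hf
        exact ((memS'_inl f).1 this).2
      · obtain ⟨hy'1, hy'2⟩ := hy'
        have : (Sum.inr y' : Coord n) ∈ S' := by simpa using hy'1
        exact ⟨((memS'_inr y').1 this).2, hy'2⟩
  · -- weight comparison
    set CF : Finset (Coord n) := (colEF n c).disjSum (∅ : Finset (Site 2)) with hCF
    set cc : Coord n → ℝ := fun i => if i ∈ CF then μ₀ else 1 with hcc
    have hq := par_mem (n := n) (p := p) (s := s) ⟨hμ₀.trans hμp, by linarith⟩ ⟨hs0, hs1⟩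
    have hfac : ∀ i ∈ K n L, cc i * ProdWeight.gwt (par p s) S i ≤ ProdWeight.gwt (par p s) S' i := by
      intro i hi
      by_cases hiC : i ∈ CF
      · -- a changed edge: finite energy
        simp only [hcc, hiC, if_true]
        obtain ⟨f, hf, rfl⟩ : ∃ f, f ∈ colEF n c ∧ Sum.inl f = i := by
          rcases Finset.mem_disjSum.1 hiC with ⟨f, hf, hfi⟩ | ⟨y', hy', -⟩
          · exact ⟨f, hf, hfi⟩
          · simp at hy'
        calc μ₀ * ProdWeight.gwt (par p s) S (Sum.inl f)
            ≤ μ₀ * 1 := mul_le_mul_of_nonneg_left (ProdWeight.gwt_le_one hq S _) hμ₀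
          _ ≤ ProdWeight.gwt (par p s) S' (Sum.inl f) := by
            rw [mul_one]
            unfold ProdWeight.gwt
            split_ifs
            · exact hμp
            · simpa [par] using hμp'
      · simp only [hcc, hiC, if_false, one_mul]
        cases i with
        | inl f =>
          have hf : f ∉ colEF n c := fun h => hiC (Finset.inl_mem_disjSum.2 h)
          have hiL : (Sum.inl f : Coord n) ∉ LocF n c := fun h => hf (Finset.inl_mem_disjSum.1 h)
          have := hoff _ hiL
          unfold ProdWeight.gwt
          by_cases h : (Sum.inl f : Coord n) ∈ S
          · have h' := this.1 h
            simp [h, h']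
          · have h' : (Sum.inl f : Coord n) ∉ S' := fun x => h (this.2 x)
            simp [h, h']
        | inr y' =>
          unfold ProdWeight.gwt
          by_cases h1 : (Sum.inr y' : Coord n) ∈ S'
          · have h2 := hinr y' h1
            simp [h1, h2]
          · by_cases h2 : (Sum.inr y' : Coord n) ∈ S
            · simp only [h2, if_true, h1, if_false, par, Sum.elim_inr]
              linarith
            · simp [h1, h2]
    have hcc0 : ∀ i ∈ K n L, 0 ≤ cc i * ProdWeight.gwt (par p s) S i := fun i _ =>
      mul_nonneg (by simp only [hcc]; split_ifs <;> linarith) (ProdWeight.gwt_nonneg hq S i)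
    have hprod : (∏ i ∈ K n L, cc i) * ProdWeight.gW (K n L) (par p s) S ≤
        ProdWeight.gW (K n L) (par p s) S' := by
      unfold ProdWeight.gW
      rw [← Finset.prod_mul_distrib]
      exact Finset.prod_le_prod hcc0 hfac
    have hcprod : μ₀ ^ (6 * n) ≤ ∏ i ∈ K n L, cc i := by
      rw [Finset.prod_ite, Finset.prod_const_one, mul_one, Finset.prod_const]
      refine pow_le_pow_of_le_one hμ₀ hμ1 ?_
      calc ((K n L).filter fun i => i ∈ CF).card ≤ CF.card :=
            Finset.card_le_card fun i hi => (Finset.mem_filter.1 hi).2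
        _ = (colEF n c).card := by rw [hCF, Finset.card_disjSum, Finset.card_empty, add_zero]
        _ ≤ 6 * n := card_colEF_le c
    calc μ₀ ^ (6 * n) * ProdWeight.gW (K n L) (par p s) S
        ≤ (∏ i ∈ K n L, cc i) * ProdWeight.gW (K n L) (par p s) S :=
          mul_le_mul_of_nonneg_right hcprod (ProdWeight.gW_nonneg _ hq S)
      _ ≤ ProdWeight.gW (K n L) (par p s) S' := hprod
  · -- agreement off `LocF c`
    ext i
    simp only [Finset.mem_filter]
    constructor
    · rintro ⟨hi, hiL⟩; exact ⟨(hoff i hiL).1 hi, hiL⟩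
    · rintro ⟨hi, hiL⟩; exact ⟨(hoff i hiL).2 hi, hiL⟩

/-- The constant of the Aizenman–Grimmett inequality for `ℋ_n` when `min(p, 1-p) ≥ μ₀`:
`C = μ₀^{-6n} · 2^{6n+5} · 30n` (finite energy · fibre multiplicity · overlap of the balls).
[cite: MartineauSevero2019, §6 ((goal) and the constant C)] -/
noncomputable def AGconst (n : ℕ) (μ₀ : ℝ) : ℝ := (μ₀ ^ (6 * n))⁻¹ * 2 ^ (6 * n + 5) * (30 * n)

/-- **Martineau–Severo's (goal), summed locally**: for one edge `e`,
`Piv_e ≤ μ₀^{-6n} 2^{6n+5} Σ_{y ∈ box L near c(e)} Piv_y`. [cite: MartineauSevero2019, §6 (goal)] -/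
theorem piv_inl_le (hn : 3 ≤ n) {L : ℕ} {p s μ₀ : ℝ} (hμ₀ : 0 < μ₀) (hμ1 : μ₀ ≤ 1)
    (hμp : μ₀ ≤ p) (hμp' : μ₀ ≤ 1 - p) (hs0 : 0 ≤ s) (hs1 : s ≤ 1) (hs : s ≤ 1 / 2)
    {e : Sym2 (Vert n)} (he : e ∈ KE n L) :
    Piv n L p s (Sum.inl e) ≤ (μ₀ ^ (6 * n))⁻¹ * 2 ^ (6 * n + 5) *
      ∑ y ∈ (box 2 L).filter (fun y => y ∈ nearF (colOf L e)), Piv n L p s (Sum.inr y) := by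
  set c := colOf L e with hc
  set q := par (n := n) p s with hq_def
  have hq := par_mem (n := n) (p := p) (s := s) ⟨hμ₀.le.trans hμp, by linarith⟩ ⟨hs0, hs1⟩
  set D : Finset (Finset (Coord n)) :=
    (K n L).powerset.filter fun S => IsPivotal (ev L) (Sum.inl e) (↑S : Set (Coord n)) with hD
  -- the modification map
  have hex : ∀ S ∈ D, ∃ S' : Finset (Coord n), S' ⊆ K n L ∧
      (∃ y ∈ box 2 L, y ∈ nearF c ∧ IsPivotal (ev L) (Sum.inr y) (↑S' : Set (Coord n))) ∧
      μ₀ ^ (6 * n) * ProdWeight.gW (K n L) q S ≤ ProdWeight.gW (K n L) q S' ∧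
      S.filter (fun i => i ∉ LocF n c) = S'.filter (fun i => i ∉ LocF n c) := by
    intro S hS
    obtain ⟨hSK, hpiv⟩ := Finset.mem_filter.1 hS
    exact exists_modified hn hμ₀.le hμ1 hμp hμp' hs0 hs1 hs he (Finset.mem_powerset.1 hSK) hpiv
  choose! Φ hΦK hΦpiv hΦw hΦoff using hex
  -- Step A: finite energy
  have hA : Piv n L p s (Sum.inl e) ≤ (μ₀ ^ (6 * n))⁻¹ * ∑ S ∈ D, ProdWeight.gW (K n L) q (Φ S) := by
    have hPiv : Piv n L p s (Sum.inl e) = ∑ S ∈ D, ProdWeight.gW (K n L) q S := by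
      rw [Piv, ProdWeight.gPiv, hD, Finset.sum_filter]
    rw [hPiv, Finset.mul_sum]
    refine Finset.sum_le_sum fun S hS => ?_
    have hμn : 0 < μ₀ ^ (6 * n) := pow_pos hμ₀ _
    rw [← div_le_iff₀' (inv_pos.2 hμn), div_inv_eq_mul, mul_comm]
    exact hΦw S hS
  -- Step B: bounded fibres
  have hB : ∑ S ∈ D, ProdWeight.gW (K n L) q (Φ S) ≤
      2 ^ (6 * n + 5) * ∑ S' ∈ D.image Φ, ProdWeight.gW (K n L) q S' := by
    rw [Finset.sum_comp, Finset.mul_sum]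
    refine Finset.sum_le_sum fun S' hS' => ?_
    rw [nsmul_eq_mul]
    refine mul_le_mul_of_nonneg_right ?_ (ProdWeight.gW_nonneg _ hq S')
    -- the fibre of `S'` injects into the power set of `LocF c`
    have hcard : (D.filter fun S => Φ S = S').card ≤ (LocF n c).powerset.card := by
      refine Finset.card_le_card_of_injOn (fun S => S.filter fun i => i ∈ LocF n c) ?_ ?_
      · intro S _
        simp only [Finset.coe_powerset, Set.mem_preimage, Set.mem_powerset_iff, Finset.coe_subset]
        exact fun i hi => (Finset.mem_filter.1 hi).2
      · intro S₁ hS₁ S₂ hS₂ hEq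
        simp only [Finset.coe_filter, Set.mem_setOf_eq] at hS₁ hS₂
        have h1 := hΦoff S₁ hS₁.1
        have h2 := hΦoff S₂ hS₂.1
        rw [hS₁.2] at h1
        rw [hS₂.2] at h2
        rw [← Finset.filter_union_filter_not_eq (fun i => i ∈ LocF n c) S₁,
          ← Finset.filter_union_filter_not_eq (fun i => i ∈ LocF n c) S₂]
        simp only at hEq
        rw [hEq, h1, ← h2]
    calc ((D.filter fun S => Φ S = S').card : ℝ) ≤ ((LocF n c).powerset.card : ℝ) := by
          exact_mod_cast hcard
      _ = 2 ^ (LocF n c).card := by rw [Finset.card_powerset]; push_cast; ring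
      _ ≤ 2 ^ (6 * n + 5) := pow_le_pow_right₀ (by norm_num) (card_LocF_le c)
  -- Step C: the images are configurations with a pivotal column near `c`
  have hC : ∑ S' ∈ D.image Φ, ProdWeight.gW (K n L) q S' ≤
      ∑ y ∈ (box 2 L).filter (fun y => y ∈ nearF c), Piv n L p s (Sum.inr y) := by
    have hsub : D.image Φ ⊆ (K n L).powerset.filter fun (S' : Finset (Coord n)) =>
        ∃ y ∈ (box 2 L).filter (fun y => y ∈ nearF c), IsPivotal (ev L) (Sum.inr y) (↑S' : Set (Coord n)) := by
      intro S' hS'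
      obtain ⟨S, hS, rfl⟩ := Finset.mem_image.1 hS'
      refine Finset.mem_filter.2 ⟨Finset.mem_powerset.2 (hΦK S hS), ?_⟩
      obtain ⟨y, hy, hyc, hpiv⟩ := hΦpiv S hS
      exact ⟨y, Finset.mem_filter.2 ⟨hy, hyc⟩, hpiv⟩
    set P : Finset (Coord n) → Prop := fun S' =>
      ∃ y ∈ (box 2 L).filter (fun y => y ∈ nearF c), IsPivotal (ev L) (Sum.inr y) (↑S' : Set (Coord n)) with hP
    set g : Finset (Coord n) → Site 2 → ℝ := fun S' y =>
      if IsPivotal (ev L) (Sum.inr y) (↑S' : Set (Coord n)) then ProdWeight.gW (K n L) q S' else 0 with hg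
    have hg0 : ∀ S' y, 0 ≤ g S' y := fun S' y => by
      simp only [hg]
      split_ifs
      · exact ProdWeight.gW_nonneg _ hq S'
      · exact le_rfl
    calc ∑ S' ∈ D.image Φ, ProdWeight.gW (K n L) q S'
        ≤ ∑ S' ∈ (K n L).powerset.filter P, ProdWeight.gW (K n L) q S' :=
          Finset.sum_le_sum_of_subset_of_nonneg hsub fun S' _ _ => ProdWeight.gW_nonneg _ hq S'
      _ ≤ ∑ S' ∈ (K n L).powerset.filter P, ∑ y ∈ (box 2 L).filter (fun y => y ∈ nearF c), g S' y := by
          refine Finset.sum_le_sum fun S' hS' => ?_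
          obtain ⟨-, y, hy, hpiv⟩ := Finset.mem_filter.1 hS'
          have hle : g S' y ≤ ∑ y' ∈ (box 2 L).filter (fun y => y ∈ nearF c), g S' y' :=
            Finset.single_le_sum (f := g S') (fun y' _ => hg0 S' y') hy
          have hgy : g S' y = ProdWeight.gW (K n L) q S' := by simp [hg, hpiv]
          rw [hgy] at hle
          exact hle
      _ ≤ ∑ S' ∈ (K n L).powerset, ∑ y ∈ (box 2 L).filter (fun y => y ∈ nearF c), g S' y :=
          Finset.sum_le_sum_of_subset_of_nonneg (Finset.filter_subset _ _) fun S' _ _ =>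
            Finset.sum_nonneg fun y _ => hg0 S' y
      _ = ∑ y ∈ (box 2 L).filter (fun y => y ∈ nearF c), Piv n L p s (Sum.inr y) := by
          rw [Finset.sum_comm]
          rfl
  -- assemble
  have h2pos : (0 : ℝ) ≤ 2 ^ (6 * n + 5) := by positivity
  have hμinv : (0 : ℝ) ≤ (μ₀ ^ (6 * n))⁻¹ := inv_nonneg.2 (pow_nonneg hμ₀.le _)
  calc Piv n L p s (Sum.inl e)
      ≤ (μ₀ ^ (6 * n))⁻¹ * ∑ S ∈ D, ProdWeight.gW (K n L) q (Φ S) := hA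
    _ ≤ (μ₀ ^ (6 * n))⁻¹ * (2 ^ (6 * n + 5) * ∑ S' ∈ D.image Φ, ProdWeight.gW (K n L) q S') :=
        mul_le_mul_of_nonneg_left hB hμinv
    _ ≤ (μ₀ ^ (6 * n))⁻¹ * (2 ^ (6 * n + 5) *
          ∑ y ∈ (box 2 L).filter (fun y => y ∈ nearF c), Piv n L p s (Sum.inr y)) :=
        mul_le_mul_of_nonneg_left (mul_le_mul_of_nonneg_left hC h2pos) hμinv
    _ = _ := by ring

/-- At most `30n` edges `e` of `KE n L` have a given column `y` near `c(e)`. [folklore] -/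
theorem card_filter_near_le (hn : n ≠ 1) (L : ℕ) (y : Site 2) :
    ((KE n L).filter fun e => y ∈ nearF (colOf L e)).card ≤ 30 * n := by
  have hsub : ((KE n L).filter fun e => y ∈ nearF (colOf L e)) ⊆ (nearF y).biUnion fun c' => colEF n c' := by
    intro e he
    rw [Finset.mem_filter] at he
    rw [Finset.mem_biUnion]
    exact ⟨colOf L e, mem_nearF_comm he.2, mem_colEF_colOf hn he.1⟩
  have h1 : ((nearF y).biUnion fun c' => colEF n c').card ≤ ∑ c' ∈ nearF y, (colEF n c').card :=
    Finset.card_biUnion_le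
  have h2 : ∑ c' ∈ nearF y, (colEF n c').card ≤ ∑ c' ∈ nearF y, 6 * n :=
    Finset.sum_le_sum fun c' _ => card_colEF_le c'
  have h3 : ∑ c' ∈ nearF y, 6 * n = (nearF y).card * (6 * n) := by
    rw [Finset.sum_const, smul_eq_mul]
  have h4 : (nearF y).card * (6 * n) ≤ 5 * (6 * n) := Nat.mul_le_mul_right _ (card_nearF_le y)
  have h5 := Finset.card_le_card hsub
  omega

/-- **The Aizenman–Grimmett inequality for the column model on `ℋ_n`** (Martineau–Severo's (goal)
summed over `e`, giving (diffineq)): if `min(p, 1-p) ≥ μ₀ > 0` and `0 ≤ s ≤ 1/2`, then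
`Σ_{e ∈ E_L} Piv_e(p,s) ≤ C(n, μ₀) · Σ_{y ∈ box L} Piv_y(p,s)`, uniformly in `L`.
[cite: MartineauSevero2019, §6 ((goal) ⟹ (diffineq))] -/
theorem sum_piv_inl_le (hn : 3 ≤ n) {L : ℕ} {p s μ₀ : ℝ} (hμ₀ : 0 < μ₀) (hμ1 : μ₀ ≤ 1)
    (hμp : μ₀ ≤ p) (hμp' : μ₀ ≤ 1 - p) (hs0 : 0 ≤ s) (hs1 : s ≤ 1) (hs : s ≤ 1 / 2) :
    ∑ e ∈ KE n L, Piv n L p s (Sum.inl e) ≤ AGconst n μ₀ * ∑ y ∈ box 2 L, Piv n L p s (Sum.inr y) := by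
  have hn1 : n ≠ 1 := by omega
  have hq := par_mem (n := n) (p := p) (s := s) ⟨hμ₀.le.trans hμp, by linarith⟩ ⟨hs0, hs1⟩
  set C₁ : ℝ := (μ₀ ^ (6 * n))⁻¹ * 2 ^ (6 * n + 5) with hC₁
  have hC₁0 : 0 ≤ C₁ := mul_nonneg (inv_nonneg.2 (pow_nonneg hμ₀.le _)) (by positivity)
  have hPiv0 : ∀ y, 0 ≤ Piv n L p s (Sum.inr y) := fun y => piv_nonneg L ⟨hμ₀.le.trans hμp, by linarith⟩ ⟨hs0, hs1⟩ _
  calc ∑ e ∈ KE n L, Piv n L p s (Sum.inl e)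
      ≤ ∑ e ∈ KE n L, C₁ * ∑ y ∈ (box 2 L).filter (fun y => y ∈ nearF (colOf L e)), Piv n L p s (Sum.inr y) :=
        Finset.sum_le_sum fun e he => piv_inl_le hn hμ₀ hμ1 hμp hμp' hs0 hs1 hs he
    _ = C₁ * ∑ e ∈ KE n L, ∑ y ∈ box 2 L,
          (if y ∈ nearF (colOf L e) then Piv n L p s (Sum.inr y) else 0) := by
        rw [← Finset.mul_sum]
        refine congrArg (C₁ * ·) (Finset.sum_congr rfl fun e _ => ?_)
        rw [Finset.sum_filter]
    _ = C₁ * ∑ y ∈ box 2 L, ∑ e ∈ KE n L,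
          (if y ∈ nearF (colOf L e) then Piv n L p s (Sum.inr y) else 0) := by
        rw [Finset.sum_comm]
    _ = C₁ * ∑ y ∈ box 2 L, (((KE n L).filter fun e => y ∈ nearF (colOf L e)).card : ℝ) * Piv n L p s (Sum.inr y) := by
        refine congrArg (C₁ * ·) (Finset.sum_congr rfl fun y _ => ?_)
        rw [← Finset.sum_filter, Finset.sum_const, nsmul_eq_mul]
    _ ≤ C₁ * ∑ y ∈ box 2 L, (30 * n : ℝ) * Piv n L p s (Sum.inr y) := by
        refine mul_le_mul_of_nonneg_left (Finset.sum_le_sum fun y _ => ?_) hC₁0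
        refine mul_le_mul_of_nonneg_right ?_ (hPiv0 y)
        exact_mod_cast card_filter_near_le hn1 L y
    _ = AGconst n μ₀ * ∑ y ∈ box 2 L, Piv n L p s (Sum.inr y) := by
        rw [← Finset.mul_sum, hC₁, AGconst]
        ring

end AG

/-! ### Integration along the line -/

section Line

variable [NeZero n]

/-- **Integration of (diffineq) along the segment `(p₀ - κt, t)`, `t ∈ [0, t₁]`** (Martineau–Severo,
§6: "(diffineq) implies that `t ↦ θ_L(𝐩(t), 𝐬(t))` is a non-decreasing function"): if
`κ · C(n, μ₀) ≤ 1`, the segment stays in `min(p, 1-p) ≥ μ₀` and `t₁ ≤ 1/2`, then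
`Θ_L(p₀, 0) ≤ Θ_L(p₀ - κ t₁, t₁)`. [cite: MartineauSevero2019, §6 (the line segment argument)] -/
theorem theta_line_mono (hn : 3 ≤ n) (L : ℕ) {p₀ κ μ₀ t₁ : ℝ} (hμ₀ : 0 < μ₀) (hμ1 : μ₀ ≤ 1)
    (hκ0 : 0 ≤ κ) (hκ : κ * AGconst n μ₀ ≤ 1) (ht₁ : 0 ≤ t₁) (ht₁' : t₁ ≤ 1 / 2)
    (hlo : μ₀ ≤ p₀ - κ * t₁) (hhi : p₀ ≤ 1 - μ₀) :
    Theta n L p₀ 0 ≤ Theta n L (p₀ - κ * t₁) t₁ := by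
  set F : ℝ → ℝ := fun t => Theta n L (p₀ - κ * t) t with hF
  have hderiv := fun t => hasDerivAt_theta_line (n := n) L p₀ κ t
  have hmono : MonotoneOn F (Set.Icc 0 t₁) := by
    refine monotoneOn_of_hasDerivWithinAt_nonneg (convex_Icc 0 t₁)
      (fun t _ => (hderiv t).continuousAt.continuousWithinAt)
      (fun t _ => (hderiv t).hasDerivWithinAt) fun t ht => ?_
    rw [interior_Icc] at ht
    have hp_lo : μ₀ ≤ p₀ - κ * t := hlo.trans (by nlinarith [ht.2.le, hκ0])
    have hp_hi : μ₀ ≤ 1 - (p₀ - κ * t) := by nlinarith [ht.1.le, hκ0]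
    have hAG := sum_piv_inl_le hn (L := L) hμ₀ hμ1 hp_lo hp_hi ht.1.le (by linarith [ht.2, ht₁'])
      (by linarith [ht.2, ht₁'])
    have hB : 0 ≤ ∑ y ∈ box 2 L, Piv n L (p₀ - κ * t) t (Sum.inr y) :=
      Finset.sum_nonneg fun y _ => piv_nonneg L ⟨hμ₀.le.trans hp_lo, by linarith⟩
        ⟨ht.1.le, by linarith [ht.2, ht₁']⟩ _
    have hC0 : 0 ≤ AGconst n μ₀ := by
      unfold AGconst
      exact mul_nonneg (mul_nonneg (inv_nonneg.2 (pow_nonneg hμ₀.le _)) (by positivity)) (by positivity)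
    nlinarith [hAG, hB, hκ, hκ0, mul_nonneg hκ0 hB]
  have h := hmono (Set.left_mem_Icc.2 ht₁) (Set.right_mem_Icc.2 ht₁) ht₁
  simpa [hF] using h

/-- **`Θ_L(p, s)` is non-decreasing in `s`** (`𝓔_L` is increasing in `α`; Russo's formula in `s`
has a non-negative right-hand side). [cite: MartineauSevero2019, §6 ("By monotonicity")] -/
theorem theta_mono_s (L : ℕ) {p s s' : ℝ} (hp0 : 0 ≤ p) (hp1 : p ≤ 1) (hs0 : 0 ≤ s)
    (hss' : s ≤ s') (hs'1 : s' ≤ 1) : Theta n L p s ≤ Theta n L p s' := by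
  set F : ℝ → ℝ := fun t => Theta n L (p - 0 * t) t with hF
  have hderiv := fun t => hasDerivAt_theta_line (n := n) L p 0 t
  have hmono : MonotoneOn F (Set.Icc 0 1) := by
    refine monotoneOn_of_hasDerivWithinAt_nonneg (convex_Icc 0 1)
      (fun t _ => (hderiv t).continuousAt.continuousWithinAt)
      (fun t _ => (hderiv t).hasDerivWithinAt) fun t ht => ?_
    rw [interior_Icc] at ht
    have hB : 0 ≤ ∑ y ∈ box 2 L, Piv n L (p - 0 * t) t (Sum.inr y) :=
      Finset.sum_nonneg fun y _ => piv_nonneg L ⟨by linarith, by linarith⟩ ⟨ht.1.le, ht.2.le⟩ _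
    simpa using hB
  have h := hmono ⟨hs0, hss'.trans hs'1⟩ ⟨hs0.trans hss', hs'1⟩ hss'
  simpa [hF] using h

end Line

end SlabTorus

end Literature.Probability.Percolation
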